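import Summits.CriticalPhenomena.PercolationContinuityZ3.Theorems.SahiMasterFamilyPhiCylinder
import Summits.CriticalPhenomena.PercolationContinuityZ3.Theorems.SahiMasterFamilyPrincipalCapLeSix

/-!
# `F(n)` at every point that deviates from the all-ones point only on singletons and pairs, every order:
# `β_S = 1` for `|S| ≥ 3`, `β_iβ_j ≤ β_ij`, `β ∈ [0,1]` ⇒ `Φ_n(β) ≥ 0` (and all honest sub-functionals)

Unit `prim-masterthm-p4` (gen 14; crux anchor stmt-CriticalPhenomena-4575, helper work; memo
`run/shared/lean/prim/prim-masterthm/prim-masterthm-p4/P4-GEN14-REPORT.md` §5).  Companion of `…PhiMinClosed` / `…PhiProduct` and gen 13's abstract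
step `PrincipalCapStep.phiSet_nonneg_of_subfamilies`.

**THEOREM** `phiSet_nonneg_of_pairLevel` (every order): if `0 ≤ β ≤ 1`, `β {i}·β {j} ≤ β {i,j}` and `β S = 1` whenever `3 ≤ |S|`, then `Φ_{n}(β) ≥ 0`;
moreover every restriction of `β` along an embedding is of the same kind, so `β` is HEREDITARILY nonnegative (`phiSet_map_nonneg_of_pairLevel`) and
products with quotient-positive functions stay nonnegative (`phiSet_pairLevel_mul_nonneg`, via `PhiProduct.phiSet_mul_nonneg`; e.g. × any min-closed
function, `…PhiCylinder.qp_of_minClosed`).  In the defect variables `d = 1 − β` (supported on singletons and pairs) this is the weighted INVOLUTION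
inequality `Σ_{σ ∈ Inv([n])} ∏_{c} d_c ≤ Σ_i Σ_{σ ∈ Inv([n]∖i)} ∏_c d_c` under `d_ij ≤ d_i + d_j − d_id_j`.  These points are in general NOT min-closed
(`β_ij ≥ β_iβ_j` only), so this family is not contained in `…PhiMinClosed`; it is a `(k + C(k,2))`-dimensional face-neighbourhood of the all-ones
vertex inside the feasible set of `PhiNonneg k`, for every k.
PROOF: strong induction through the abstract step — the honest sub-functionals avoiding one index are of the same kind one order down when their
ground set has ≥ 3 elements (top value 1), and are `β_i ≥ 0`, `β_ij − β_iβ_j ≥ 0` otherwise (`phiSet_one`, `phiSet_two`).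
HONEST FRAMING: an explicit region of `F(k)` for every k; `PhiNonneg k` (k ≥ 8), Sahi's `C_k`, Kahn's Conjecture 5, the master theorem remain OPEN.
Axioms standard. [this work]
-/

noncomputable section

open scoped Classical

namespace Summit.CriticalPhenomena.PercolationContinuityZ3.Theorems

namespace PhiPairLevel

open Finset Function
open Literature.Combinatorics.Sahi2008
open PrincipalCapBeta (phiSet)

/-- **Pair-level points are Sahi-nonnegative at every order** (arity `n ≥ 1`; the hypotheses are on `Finset (Fin n)`). [this work] -/
theorem phiSet_nonneg_of_pairLevel : ∀ (n : ℕ) (β : Finset (Fin (n + 1)) → ℝ), (∀ B, 0 ≤ β B) → (∀ B, β B ≤ 1) →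
    (∀ i j : Fin (n + 1), β {i} * β {j} ≤ β ({i} ∪ {j})) → (∀ S, 3 ≤ S.card → β S = 1) → 0 ≤ phiSet (n + 1) β := by
  intro n
  induction n using Nat.strong_induction_on with
  | _ n ih =>
  intro β h0 h1 hpair h3
  rcases Nat.lt_or_ge n 2 with hn | hn
  · -- n + 1 ∈ {1, 2}: explicit
    interval_cases n
    · rw [PrincipalCapBeta.phiSet_one]; exact h0 _
    · rw [PrincipalCapBeta.phiSet_two]
      have h := hpair 0 1
      have e : ({0} ∪ {1} : Finset (Fin 2)) = univ := by decide
      rw [e] at h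
      linarith
  · -- n + 1 ≥ 3: top value 1, abstract step
    have htop : β univ = 1 := h3 univ (by rw [card_univ, Fintype.card_fin]; omega)
    refine PrincipalCapStep.phiSet_nonneg_of_subfamilies β h1 htop fun m e he => ?_
    refine ih m (PhiVertex.lt_of_emb_ne_last e he) (fun S => β (S.map e)) (fun B => h0 _) (fun B => h1 _) (fun i j => ?_) (fun S hS => ?_)
    · have e1 : (({i} ∪ {j} : Finset (Fin (m + 1))).map e) = {e i} ∪ {e j} := by
        rw [Finset.map_union, Finset.map_singleton, Finset.map_singleton]
      show β (({i} : Finset (Fin (m + 1))).map e) * β (({j} : Finset (Fin (m + 1))).map e) ≤ β (({i} ∪ {j} : Finset (Fin (m + 1))).map e)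
      rw [Finset.map_singleton, Finset.map_singleton, e1]
      exact hpair _ _
    · exact h3 _ (by rw [card_map]; exact hS)

/-- The hereditary form: every restriction of a pair-level point is nonnegative. [this work] -/
theorem phiSet_map_nonneg_of_pairLevel {n : ℕ} (β : Finset (Fin n) → ℝ) (h0 : ∀ B, 0 ≤ β B) (h1 : ∀ B, β B ≤ 1)
    (hpair : ∀ i j : Fin n, β {i} * β {j} ≤ β ({i} ∪ {j})) (h3 : ∀ S, 3 ≤ S.card → β S = 1)
    (L : ℕ) (e : Fin L ↪ Fin n) : 0 ≤ phiSet L (fun S => β (S.map e)) := by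
  cases L with
  | zero => exact PhiProduct.phiSet_zero_nonneg _
  | succ l =>
    refine phiSet_nonneg_of_pairLevel l _ (fun B => h0 _) (fun B => h1 _) (fun i j => ?_) (fun S hS => h3 _ (by rw [card_map]; exact hS))
    have e1 : (({i} ∪ {j} : Finset (Fin (l + 1))).map e) = {e i} ∪ {e j} := by
      rw [Finset.map_union, Finset.map_singleton, Finset.map_singleton]
    show β (({i} : Finset (Fin (l + 1))).map e) * β (({j} : Finset (Fin (l + 1))).map e) ≤ β (({i} ∪ {j} : Finset (Fin (l + 1))).map e)
    rw [Finset.map_singleton, Finset.map_singleton, e1]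
    exact hpair _ _

/-- **Products**: a pair-level point times a quotient-positive function (e.g. a min-closed one) is nonnegative, every order. [this work] -/
theorem phiSet_pairLevel_mul_nonneg {n : ℕ} (β : Finset (Fin (n + 1)) → ℝ) (h0 : ∀ B, 0 ≤ β B) (h1 : ∀ B, β B ≤ 1)
    (hpair : ∀ i j : Fin (n + 1), β {i} * β {j} ≤ β ({i} ∪ {j})) (h3 : ∀ S, 3 ≤ S.card → β S = 1)
    (b : Finset (Fin (n + 1)) → ℝ)
    (hb : ∀ (L : ℕ) (B : Fin L → Finset (Fin (n + 1))), (∀ i j, i ≠ j → Disjoint (B i) (B j)) →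
      0 ≤ phiSet L (fun Q => b (Q.biUnion B))) :
    0 ≤ phiSet (n + 1) (fun S => β S * b S) :=
  PhiProduct.phiSet_mul_nonneg β b (phiSet_map_nonneg_of_pairLevel β h0 h1 hpair h3) hb

/-- In particular × a min-closed `[0,1]`-valued function. [this work] -/
theorem phiSet_pairLevel_mul_minClosed_nonneg {n : ℕ} (β : Finset (Fin (n + 1)) → ℝ) (h0 : ∀ B, 0 ≤ β B) (h1 : ∀ B, β B ≤ 1)
    (hpair : ∀ i j : Fin (n + 1), β {i} * β {j} ≤ β ({i} ∪ {j})) (h3 : ∀ S, 3 ≤ S.card → β S = 1)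
    (b : Finset (Fin (n + 1)) → ℝ) (hb0 : ∀ B, 0 ≤ b B) (hb1 : ∀ B, b B ≤ 1) (hmin : ∀ S T, min (b S) (b T) ≤ b (S ∪ T)) :
    0 ≤ phiSet (n + 1) (fun S => β S * b S) :=
  phiSet_pairLevel_mul_nonneg β h0 h1 hpair h3 b (PhiCylinder.qp_of_minClosed b hb0 hb1 hmin)

end PhiPairLevel

end Summit.CriticalPhenomena.PercolationContinuityZ3.Theorems
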